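import Summits.QuantumFields.YangMills.Theorems.AlphaInputsT3ACv3AdaptedClass
import HarnessLib

/-!
# `AlphaInputsT3ACv3AdaptedClassUnit` — STRATEGY B for 2′: NON-VACUITY OF THE ADAPTED CLASS AT THE TRIVIAL HISTORY — the unit configuration
# `Ũ ≡ 1` lies in `𝒞(k, triv, W)` for every uncharged datum `W` and for the trivial datum `W ≡ 1` (`k ≤ K`) — lane `pub-balaban3d`, seat alpha-2 (g0)

WHY.  The displayed row (D6) `AlphaInputsT3AC.AdaptedClassNonemptyT3` of `DataSchemaT3AC` (sibling `AlphaInputsT3ACv3DataSchema`) asserts non-emptiness of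
the adapted class `AlphaInputsT3AC.adaptedClassT3` (`AlphaInputsT3ACv3AdaptedClass`) at the NON-trivial admissible histories; this file records the kernel
check that the class's closed-form constraints are jointly consistent where no largeness is asked: at `h = triv` (`disc triv = ∅`, `Ω_j(triv) = T`) the unit
configuration is in both small-loop classes (`one_mem_nestedSmall_expMeanLogSU`, NODE O's `one_mem_argClassC`), in [7]'s closed regular class (NODE O's
`one_mem_regClassC`), trivially (67)-large (no recorded plaquettes), (68)-regular at every level (`(blockAvg ℰp)^s 1 = 1`, `|1 − 1| = 0`), and satisfies the
(42)-top constraint of the datum `W ≡ 1`.  THEOREMS ONLY; count-neutral; (D6) itself (non-trivial histories: abelian witnesses + smooth lifts) is NOT proved here.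
Nothing about d = 4, the continuum, or a mass gap.

References: T. Bałaban, Commun. Math. Phys. 102 (1985) 255–275 [Balaban1985UV3] ((42) p.266, (47) p.267 «the only term», (67)–(68) p.273).
-/

set_option autoImplicit false

noncomputable section

namespace Summit.QuantumFields.YangMills.Theorems

open MeasureTheory Set
open scoped Matrix Matrix.Norms.L2Operator
open Literature.MathematicalPhysics.QuantumFieldTheory.Balaban1983to89
open Literature.MathematicalPhysics.QuantumFieldTheory.Balaban1983to89.B10 (pFun)
open Literature.MathematicalPhysics.QuantumFieldTheory.Balaban1983to89.T3ContinuumYM3Torus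
open Literature.MathematicalPhysics.QuantumFieldTheory.Balaban1983to89.T3UnitLawDensityEML (ℰp)
open Literature.MathematicalPhysics.QuantumFieldTheory.Balaban1983to89.T3UnitScaleTilt (θBal)
open Literature.MathematicalPhysics.QuantumFieldTheory.Balaban1983to89.T3Thresholds (θBal_eq coupling_le_one)
open Literature.MathematicalPhysics.QuantumFieldTheory.Balaban1983to89.T3ThresholdSmallness (sqrt_coupling_pos_le)
open Literature.MathematicalPhysics.QuantumFieldTheory.Balaban1983to89.B10Eq38TorusDomains (plaqsIn)
open Literature.MathematicalPhysics.QuantumFieldTheory.Balaban1983to89.B10Eq42TorusConstraint (bondsIn lam42)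
open Literature.MathematicalPhysics.QuantumFieldTheory.Balaban1985CMP102.Setting
open Summit.QuantumFields.Balaban3D.Carriers
open Summit.QuantumFields.Balaban3D.Proofs.Primitives (AlphaConsts)
open Summit.QuantumFields.BalabanUV.T4Continuum.SubstrateBlockAvgContinuity (NestedSmall one_mem_nestedSmall_expMeanLogSU blockAvg_expMeanLogSU_one)
open Summit.QuantumFields.YangMills.Theorems.BalabanUVNodesN08AlphaArgClass (argClassC one_mem_argClassC)
open Summit.QuantumFields.YangMills.Theorems.BalabanUVNodesN08AlphaCompactSel (regClassC one_mem_regClassC)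

section T3

variable {F : T3Family} {𝔠 : AlphaConsts F.L (suGroupModel 2).N} {γ : ℝ} {hγ : 0 < γ} {hγ1 : γ ≤ (min 𝔠.gamma0 1) ^ 2} {K : ℕ}

/-- `Ū^s(1) = 1`: every iterate of the family's block averaging fixes the unit configuration (`blockAvg_expMeanLogSU_one`). [cite: Balaban1987RG1, (0.4) p.253] -/
theorem AlphaInputsT3AC.iter_blockAvg_ℰp_one : ∀ s : ℕ,
    Averaging.iter (fun l => BlockAveraging.blockAvg (P := F.P K) (j := l) ℰp) s (1 : GaugeField (F.P K) 0 (Matrix.specialUnitaryGroup (Fin 2) ℂ)) = 1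
  | 0 => rfl
  | s + 1 => by
    show (BlockAveraging.blockAvg (P := F.P K) (j := s) ℰp).avg
        (Averaging.iter (fun l => BlockAveraging.blockAvg (P := F.P K) (j := l) ℰp) s 1) = 1
    rw [AlphaInputsT3AC.iter_blockAvg_ℰp_one s]
    exact blockAvg_expMeanLogSU_one (F.P K) s

/-- The plaquette variables of the unit configuration are `1`. [cite: Balaban1985Averaging, (9) p.18] -/
theorem AlphaInputsT3AC.plaqHol_one_cfg {P : Params} {j : ℕ} {G : Type*} [GaugeGroup G] (p : Plaq P j) :
    GaugeField.plaqHol (1 : GaugeField P j G) p = 1 := by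
  show (1 : G) * 1 * (1 : G)⁻¹ * (1 : G)⁻¹ = 1
  simp

/-- At the trivial history the (67)-largeness set is everything (no recorded plaquettes: `disc triv = ∅`). [cite: Balaban1985UV3, (47) p.267] -/
theorem AlphaInputsT3AC.large67Set_triv (k : ℕ) :
    AlphaInputsT3AC.large67Set F 𝔠 γ hγ hγ1 K k (Hist.triv (F.P K) k) = Set.univ := by
  ext U
  simp only [AlphaInputsT3AC.large67Set, Hist.disc_triv, Finset.notMem_empty, false_imp_iff, implies_true, mem_setOf_eq, mem_univ]

/-- `0 ≤ θBal` on the package's coupling window. [cite: Balaban1985UV3, (7) p.257] -/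
theorem AlphaInputsT3AC.θBal_nonneg_window (hγ : 0 < γ) (hγ1 : γ ≤ (min 𝔠.gamma0 1) ^ 2) (i : ℕ) : 0 ≤ θBal F.L γ 𝔠.b₀ 𝔠.p₀ i := by
  have hL : 1 ≤ F.L := F.hL.2.le
  have hγ1' : γ ≤ 1 := hγ1.trans (sq_min_one_le _ 𝔠.gamma0_pos)
  rw [θBal_eq]
  exact mul_nonneg (Real.sqrt_nonneg _)
    (B10.pFun_nonneg 𝔠.b₀ 𝔠.p₀ _ 𝔠.b₀_pos.le (sqrt_coupling_pos_le hL hγ i).1 (coupling_le_one hL hγ hγ1' i))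

/-- The unit configuration is (68)-regular at every level, for every history (`Ū^s(1) = 1`, `|1 − 1| = 0 ≤ C68·θ·L^{−2(i−s)}`). [cite: Balaban1985UV3, (68) p.273] -/
theorem AlphaInputsT3AC.one_mem_reg68LevelsSet (k : ℕ) (h : Hist (F.P K) k) :
    (1 : GaugeField (F.P K) 0 (Matrix.specialUnitaryGroup (Fin 2) ℂ)) ∈ AlphaInputsT3AC.reg68LevelsSet F 𝔠 γ hγ hγ1 K k h := by
  intro i _ s _ q _
  rw [AlphaInputsT3AC.iter_blockAvg_ℰp_one s, AlphaInputsT3AC.plaqHol_one_cfg, GaugeGroup.dist1_one]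
  exact mul_nonneg (mul_nonneg 𝔠.C68_pos.le (AlphaInputsT3AC.θBal_nonneg_window hγ hγ1 (K - i))) (by positivity)

/-- The unit configuration satisfies the (42)-top constraint of the unit datum, for every history. [cite: Balaban1985UV3, (42) p.266] -/
theorem AlphaInputsT3AC.one_mem_top42Set_one (k : ℕ) (h : Hist (F.P K) k) :
    (1 : GaugeField (F.P K) 0 (Matrix.specialUnitaryGroup (Fin 2) ℂ)) ∈ AlphaInputsT3AC.top42Set F 𝔠 γ hγ hγ1 K k h 1 := by
  intro b _
  rw [AlphaInputsT3AC.iter_blockAvg_ℰp_one k]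

/-- **THE W-INDEPENDENT CORE AT THE TRIVIAL HISTORY CONTAINS `1`** (`k ≤ K`): both small-loop classes, [7]'s closed regular class, and (trivially) the
(67)-largeness set. [cite: Balaban1985UV3, (47) p.267 + (68) p.273] -/
theorem AlphaInputsT3AC.one_mem_adaptedCore_triv {k : ℕ} (hk : k ≤ K) :
    (1 : GaugeField (F.P K) 0 (Matrix.specialUnitaryGroup (Fin 2) ℂ)) ∈ NestedSmall (P := F.P K) ℰp (ℰp.δ / 2) k ∧
    (1 : GaugeField (F.P K) 0 (Matrix.specialUnitaryGroup (Fin 2) ℂ)) ∈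
      argClassC (S := T3Scales F γ hγ (hγ1.trans (sq_min_one_le _ 𝔠.gamma0_pos)) K) (suGroupModel 2) k ∧
    (1 : GaugeField (F.P K) 0 (Matrix.specialUnitaryGroup (Fin 2) ℂ)) ∈
      regClassC (S := T3Scales F γ hγ (hγ1.trans (sq_min_one_le _ 𝔠.gamma0_pos)) K) (suGroupModel 2) 𝔠 k (Hist.triv (F.P K) k) ∧
    (1 : GaugeField (F.P K) 0 (Matrix.specialUnitaryGroup (Fin 2) ℂ)) ∈ AlphaInputsT3AC.large67Set F 𝔠 γ hγ hγ1 K k (Hist.triv (F.P K) k) := by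
  refine ⟨one_mem_nestedSmall_expMeanLogSU (by linarith [ℰp.δ_pos]) k, one_mem_argClassC _ k,
    one_mem_regClassC (S := T3Scales F γ hγ (hγ1.trans (sq_min_one_le _ 𝔠.gamma0_pos)) K) (suGroupModel 2) 𝔠 hk _, ?_⟩
  rw [AlphaInputsT3AC.large67Set_triv]
  exact mem_univ _

/-- **NON-VACUITY AT THE TRIVIAL HISTORY, UNCHARGED DATUM**: `1 ∈ 𝒞(k, triv, W)` whenever `W` is NOT charged (`k ≤ K`). [cite: Balaban1985UV3, (47) p.267] -/
theorem AlphaInputsT3AC.one_mem_adaptedClassT3_triv_of_not_charged {k : ℕ} (hk : k ≤ K)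
    {W : GaugeField (F.P K) k (Matrix.specialUnitaryGroup (Fin 2) ℂ)}
    (hW : ¬ ChargedT3 F γ 𝔠.b₀ 𝔠.p₀ (avgWindowFactor F.L) K 𝔠.lane.carrier.M₁
      (rcolOf (T3Scales F γ hγ (hγ1.trans (sq_min_one_le _ 𝔠.gamma0_pos)) K) 𝔠.lane.carrier) k (Hist.triv (F.P K) k) W) :
    (1 : GaugeField (F.P K) 0 (Matrix.specialUnitaryGroup (Fin 2) ℂ)) ∈ AlphaInputsT3AC.adaptedClassT3 F 𝔠 γ hγ hγ1 K k (Hist.triv (F.P K) k) W := by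
  obtain ⟨h1, h2, h3, h4⟩ := AlphaInputsT3AC.one_mem_adaptedCore_triv (F := F) (𝔠 := 𝔠) (γ := γ) (hγ := hγ) (hγ1 := hγ1) (K := K) hk
  exact ⟨h1, h2, h3, h4, fun hc => absurd hc hW⟩

/-- **NON-VACUITY AT THE TRIVIAL HISTORY, TRIVIAL DATUM**: `1 ∈ 𝒞(k, triv, 1)` (`k ≤ K`) — the top constraint and the multi-level regularity hold for
`Ũ ≡ 1`, `W ≡ 1` whether or not the datum is charged. [cite: Balaban1985UV3, (42) p.266 + (47) p.267 + (68) p.273] -/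
theorem AlphaInputsT3AC.one_mem_adaptedClassT3_triv_one {k : ℕ} (hk : k ≤ K) :
    (1 : GaugeField (F.P K) 0 (Matrix.specialUnitaryGroup (Fin 2) ℂ)) ∈
      AlphaInputsT3AC.adaptedClassT3 F 𝔠 γ hγ hγ1 K k (Hist.triv (F.P K) k) 1 := by
  obtain ⟨h1, h2, h3, h4⟩ := AlphaInputsT3AC.one_mem_adaptedCore_triv (F := F) (𝔠 := 𝔠) (γ := γ) (hγ := hγ) (hγ1 := hγ1) (K := K) hk
  exact ⟨h1, h2, h3, h4, fun _ => ⟨AlphaInputsT3AC.one_mem_top42Set_one (hγ := hγ) (hγ1 := hγ1) k _,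
    AlphaInputsT3AC.one_mem_reg68LevelsSet (hγ := hγ) (hγ1 := hγ1) k _⟩⟩

/-- Hence the adapted class of the trivial datum at the trivial history is NON-EMPTY (`k ≤ K`). [cite: Balaban1985UV3, (47) p.267] -/
theorem AlphaInputsT3AC.adaptedClassT3_triv_one_nonempty {k : ℕ} (hk : k ≤ K) :
    (AlphaInputsT3AC.adaptedClassT3 F 𝔠 γ hγ hγ1 K k (Hist.triv (F.P K) k) 1).Nonempty :=
  ⟨1, AlphaInputsT3AC.one_mem_adaptedClassT3_triv_one (𝔠 := 𝔠) (hγ1 := hγ1) hk⟩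

end T3

end Summit.QuantumFields.YangMills.Theorems

end
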